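import Summits.Ventures.PercRepro.S1CoreCapSpecSpreadSixLinesC
import Summits.Ventures.PercRepro.S1CoreCapSpecSpreadSixHeavy
import Summits.Ventures.PercRepro.S1CoreCapSpreadChain

/-!
# PercRepro — THE INSTANCE `ν = 6` OF THE SPREAD SPEC, PROVED: `FourCapSpecSpread capPaper 6 9` (p1, gen 32)

`proofs/P1-S2-CORANK6.md` §4h. The search `fourcap_spread3.py` (`maxlines = 12`, 180 states) reads `Q*_spread(6) = 9` against the kernel
`Q*(6) = 16`; here it is a theorem, by the assembly of `fourCapSpecSpread_five` with the nullity-`6` counts: a simple 4-point line beside at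
most five simple 3-point lines (`card_le_six_of_weight_four_six`: `4 + 5 = 9`, the maximiser — a 4-line, a 3-line through it and a
disjoint `K₄`), a fat point of degree `≤ 2` (`#lines + d ≤ 6 + 1` or `6 + 2`), all simple 3-point lines at most nine
(`card_le_nine_of_three_points_spread_six`). THEN THE SPREAD CHAIN AT NULLITY `6` (§4i): the spread per-point table `qSpread = 0, 1, 4, 5, 6, 8, 9`
is kernel-certified up to nullity `6` (`fourCapSpecSpread_qSpread`), so **`s₄ ≤ 33` on every spread e-free core of nullity `6`**
(`ncard_fourCircuits_le_thirty_three_spread`) and, by the averaging recursion inside the spread class, **`s₄ ≤ 40` on a spread coloop-free core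
of nullity `7` on `21` points (the `(14, 7)` cell; `s − ⌊4s/21⌋ ≤ 33`; the global cap was `56`)** (`ncard_fourCircuits_le_forty_spread_twenty_one`).
Nothing here closes a cell (§4c: the `s₅ / s₆` spread caps remain). Axioms: standard.
-/

namespace PercRepro

namespace S1

namespace FourCap

variable {β : Type} [DecidableEq β]

/-- **THE INSTANCE `ν = 6` OF THE SPREAD SPEC, PROVED**: `FourCapSpecSpread capPaper 6 9` — the search's `Q*_spread(6) = 9` (against
`Q*(6) = 16`). Assembly: at most two lines ⟹ `≤ 5`; three or more lines ⟹ every line has weight `≤ 4`; a simple 4-point line beside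
simple 3-point lines ⟹ `4 + 5`; a fat point of degree `d ≤ 2` ⟹ `#lines + d ≤ 6 + 2`; all simple 3-point lines ⟹ `≤ 9`. -/
theorem fourCapSpecSpread_six : FourCapSpecSpread capPaper 6 9 := by
  intro β _ w ls h1 h2 h3 h4 _ _ h7
  by_cases hbig : 2 < ls.card
  · -- every line has weight `≤ 4`
    have hw4 : ∀ L ∈ ls, wsum w L ≤ 4 := by
      intro L hL
      obtain ⟨L', hL', hne⟩ := Finset.exists_mem_ne (by omega : 1 < ls.card) L
      exact wsum_le_four_of_two_spread h1 h2 h3 h7 hL hL' hne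
    by_cases hex4 : ∃ L ∈ ls, L.card = 4
    · -- a simple 4-point line: every other line is a simple 3-point line, at most four of them
      obtain ⟨L₁, hL₁, hc4⟩ := hex4
      have hcf₁ := wsum_eq_card_add_fat w L₁ (h1 L₁ hL₁)
      have hw₁ := hw4 L₁ hL₁
      have hwL₁ : wsum w L₁ = 4 := by omega
      have hf₁ : fat w L₁ = 0 := by omega
      have hoth : ∀ L ∈ ls, L ≠ L₁ → L.card = 3 ∧ wsum w L = 3 := by
        intro L hL hne
        have hw3 := wsum_eq_three_of_beside_weight_four h1 h2 h3 h7 hL₁ hwL₁ hf₁ hL hne (hw4 L hL)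
        have := card_le_wsum w L (h1 L hL)
        have := (h2 L hL).1
        exact ⟨by omega, hw3⟩
      have hm := card_le_six_of_weight_four_six h1 h2 h3 h4 h7 hL₁ hwL₁ hoth
      have hothers : ∀ L ∈ ls.erase L₁, capPaper L.card (fat w L) = 1 := by
        intro L hL
        rw [Finset.mem_erase] at hL
        obtain ⟨hc, hw⟩ := hoth L hL.2 hL.1
        have hcf := wsum_eq_card_add_fat w L (h1 L hL.2)
        have hf0 : fat w L = 0 := by omega
        rw [hc, hf0]
        decide
      rw [← Finset.add_sum_erase ls _ hL₁, Finset.sum_congr rfl hothers, Finset.sum_const_nat (fun _ _ => rfl),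
        Finset.card_erase_of_mem hL₁, hc4, hf₁]
      have : capPaper 4 0 = 4 := by decide
      omega
    · push Not at hex4
      -- every line has three points and at most one fat point
      have hc3 : ∀ L ∈ ls, L.card = 3 := by
        intro L hL
        have := card_le_wsum w L (h1 L hL)
        have := (h2 L hL).1
        have := hw4 L hL
        have := hex4 L hL
        omega
      have hf1 : ∀ L ∈ ls, fat w L ≤ 1 := by
        intro L hL
        have := wsum_eq_card_add_fat w L (h1 L hL)
        have := hw4 L hL
        have := hc3 L hL
        omega
      have hsum : ∑ L ∈ ls, capPaper L.card (fat w L) = ls.card + ∑ L ∈ ls, fat w L := by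
        rw [Finset.card_eq_sum_ones, ← Finset.sum_add_distrib]
        exact Finset.sum_congr rfl (fun L hL => by rw [hc3 L hL]; exact capPaper_three_eq_one_add (hf1 L hL))
      by_cases hfat : ∃ F ∈ ls, fat w F = 1
      · -- a fat point `p`
        obtain ⟨F, hF, hfF⟩ := hfat
        obtain ⟨p, hp⟩ := Finset.card_eq_one.1 hfF
        have hpF : p ∈ F ∧ w p = 2 := Finset.mem_filter.1 (hp ▸ Finset.mem_singleton_self p)
        have hwF : wsum w F = 4 := by
          have := wsum_eq_card_add_fat w F (h1 F hF); have := hc3 F hF; omega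
        -- the lines through `p` are the one-fat lines
        have hthrough : ∀ L ∈ ls, fat w L = if p ∈ L then 1 else 0 := by
          intro L hL
          by_cases hpL : p ∈ L
          · rw [if_pos hpL]
            have : 1 ≤ fat w L := by
              unfold fat
              exact Finset.card_pos.2 ⟨p, Finset.mem_filter.2 ⟨hpL, hpF.2⟩⟩
            have := hf1 L hL
            omega
          · rw [if_neg hpL]
            by_contra hne
            have hfL : fat w L = 1 := by have := hf1 L hL; omega
            have hwL : wsum w L = 4 := by
              have := wsum_eq_card_add_fat w L (h1 L hL); have := hc3 L hL; omega
            have hLF : L ≠ F := fun h => hpL (h ▸ hpF.1)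
            exact hpL (fat_line_through h1 h3 h7 hF hL hLF (hc3 F hF) hwF hpF.1 hpF.2 (hc3 L hL) hwL)
        have hsumfat : ∑ L ∈ ls, fat w L = (ls.filter (fun L => p ∈ L)).card := by
          rw [Finset.card_filter]
          exact Finset.sum_congr rfl hthrough
        set P := ls.filter (fun L => p ∈ L) with hP
        have hFP : F ∈ P := Finset.mem_filter.2 ⟨hF, hpF.1⟩
        have hP2 : P.card ≤ 2 := by
          by_contra hlt
          push Not at hlt
          obtain ⟨F₁, F₂, F₃, hF₁, hF₂, hF₃, h12, h13, h23⟩ := Finset.two_lt_card_iff.1 hlt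
          simp only [hP, Finset.mem_filter] at hF₁ hF₂ hF₃
          have hw₁ : wsum w F₁ = 4 := by
            have := wsum_eq_card_add_fat w F₁ (h1 F₁ hF₁.1); have := hc3 F₁ hF₁.1; have := hthrough F₁ hF₁.1
            rw [if_pos hF₁.2] at this; omega
          have hw₂ : wsum w F₂ = 4 := by
            have := wsum_eq_card_add_fat w F₂ (h1 F₂ hF₂.1); have := hc3 F₂ hF₂.1; have := hthrough F₂ hF₂.1
            rw [if_pos hF₂.2] at this; omega
          have hw₃ : wsum w F₃ = 4 := by
            have := wsum_eq_card_add_fat w F₃ (h1 F₃ hF₃.1); have := hc3 F₃ hF₃.1; have := hthrough F₃ hF₃.1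
            rw [if_pos hF₃.2] at this; omega
          exact not_three_through_fat h1 h3 h7 hF₁.1 hF₂.1 hF₃.1 h12.symm h13.symm h23.symm (hc3 F₁ hF₁.1)
            (hc3 F₂ hF₂.1) (hc3 F₃ hF₃.1) hw₁ hw₂ hw₃ hF₁.2 hF₂.2 hF₃.2 hpF.2
        have hP1 : 1 ≤ P.card := Finset.card_pos.2 ⟨F, hFP⟩
        -- a line avoiding `p` is a simple 3-point line
        have hsimple : ∀ L ∈ ls, p ∉ L → L.card = 3 ∧ wsum w L = 3 := by
          intro L hL hpL
          have := hthrough L hL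
          rw [if_neg hpL] at this
          have := wsum_eq_card_add_fat w L (h1 L hL)
          have := hc3 L hL
          exact ⟨hc3 L hL, by omega⟩
        rw [hsum, hsumfat]
        rcases (by omega : P.card = 1 ∨ P.card = 2) with hd1 | hd2
        · -- one one-fat line: `card_le_five_of_weight_four`
          have hPeq : P = {F} := by
            rw [Finset.card_eq_one] at hd1
            obtain ⟨G, hG⟩ := hd1
            rw [hG] at hFP
            rw [Finset.mem_singleton] at hFP
            rw [hG, hFP]
          have hoth : ∀ L ∈ ls, L ≠ F → L.card = 3 ∧ wsum w L = 3 := by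
            intro L hL hne
            refine hsimple L hL (fun hpL => hne ?_)
            have : L ∈ P := Finset.mem_filter.2 ⟨hL, hpL⟩
            rw [hPeq, Finset.mem_singleton] at this
            exact this
          have := card_le_six_of_weight_four_six h1 h2 h3 h4 h7 hF hwF hoth
          omega
        · -- two one-fat lines through `p`: `card_le_four_of_two_fat`
          obtain ⟨F₁, F₂, hne, hPeq⟩ := Finset.card_eq_two.1 hd2
          have hF₁ : F₁ ∈ ls ∧ p ∈ F₁ := Finset.mem_filter.1 (hPeq ▸ (by simp : F₁ ∈ ({F₁, F₂} : Finset (Finset β))))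
          have hF₂ : F₂ ∈ ls ∧ p ∈ F₂ := Finset.mem_filter.1 (hPeq ▸ (by simp : F₂ ∈ ({F₁, F₂} : Finset (Finset β))))
          have hw₁ : wsum w F₁ = 4 := by
            have := wsum_eq_card_add_fat w F₁ (h1 F₁ hF₁.1); have := hc3 F₁ hF₁.1; have := hthrough F₁ hF₁.1
            rw [if_pos hF₁.2] at this; omega
          have hw₂ : wsum w F₂ = 4 := by
            have := wsum_eq_card_add_fat w F₂ (h1 F₂ hF₂.1); have := hc3 F₂ hF₂.1; have := hthrough F₂ hF₂.1
            rw [if_pos hF₂.2] at this; omega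
          have hoth : ∀ L ∈ ls, L ≠ F₁ → L ≠ F₂ → L.card = 3 ∧ wsum w L = 3 := by
            intro L hL hne1 hne2
            refine hsimple L hL (fun hpL => ?_)
            have : L ∈ P := Finset.mem_filter.2 ⟨hL, hpL⟩
            rw [hPeq, Finset.mem_insert, Finset.mem_singleton] at this
            rcases this with h | h
            · exact hne1 h
            · exact hne2 h
          have := card_le_six_of_two_fat_six h1 h2 h3 h4 h7 hF₁.1 hF₂.1 hne.symm (hc3 F₁ hF₁.1) (hc3 F₂ hF₂.1) hw₁ hw₂
            hF₁.2 hF₂.2 hpF.2 hoth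
          omega
      · -- every line is a simple 3-point line: at most seven
        push Not at hfat
        have hf0 : ∀ L ∈ ls, fat w L = 0 := by
          intro L hL
          have := hf1 L hL
          have := hfat L hL
          omega
        have hw1 : ∀ L ∈ ls, ∀ v ∈ L, w v = 1 := by
          intro L hL v hv
          rcases h1 L hL v hv with h | h
          · exact h
          · exfalso
            have : 0 < fat w L := by
              unfold fat
              exact Finset.card_pos.2 ⟨v, Finset.mem_filter.2 ⟨hv, h⟩⟩
            have := hf0 L hL
            omega
        have hm := card_le_nine_of_three_points_spread_six hw1 hc3 h3 h7 h4
        rw [hsum, Finset.sum_congr rfl hf0, Finset.sum_const_nat (fun _ _ => rfl)]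
        omega
  · push Not at hbig
    rcases (by omega : ls.card = 0 ∨ ls.card = 1 ∨ ls.card = 2) with h0 | hone | htwo
    · rw [Finset.card_eq_zero.1 h0]
      simp
    · obtain ⟨L, rfl⟩ := Finset.card_eq_one.1 hone
      rw [Finset.sum_singleton]
      have hk := h2 L (Finset.mem_singleton_self L)
      have hcf := wsum_eq_card_add_fat w L (h1 L (Finset.mem_singleton_self L))
      exact (capPaper_le_five hk.1 (by omega)).trans (by omega)
    · obtain ⟨L, L', hne, rfl⟩ := Finset.card_eq_two.1 htwo
      rw [Finset.sum_pair hne]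
      exact (cap_add_cap_le_five_spread h1 h2 h3 h7 (by simp) (by simp) hne.symm).trans (by omega)

end FourCap

open scoped Matroid

open Set

open FourCap

variable {α : Type}

/-- **The kernel instances of the spread spec up to nullity `6`**: `0, 1, 4, 5` from the plain instances, `6, 8, 9` from
`fourCapSpecSpread_four / _five / _six`. -/
theorem fourCapSpecSpread_qSpread : ∀ j ≤ 6, FourCapSpecSpread capPaper j (qSpread j) := by
  intro j hj
  by_cases hj5 : j ≤ 5
  · exact fourCapSpecSpread_qSpread_five j hj5
  · have : j = 6 := by omega
    subst this
    exact fourCapSpecSpread_six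

/-- **`s₄ ≤ 33` on every spread e-free core of nullity `6`.** -/
theorem ncard_fourCircuits_le_thirty_three_spread (M : Matroid α) [M.Finite]
    (hfree : ∀ e ∈ M.E, ∃ A ⊆ M.E \ {e}, e ∉ M.closure A ∧ e ∉ M.closure ((M.E \ {e}) \ A))
    (hns : ¬ ∃ W ⊆ M.E, W.ncard ≤ 9 ∧ W.encard = M.eRk W + 4) (hd : M.E.encard = M.eRank + 6) :
    {C : Set α | M.IsCircuit C ∧ C.ncard = 4}.ncard ≤ 33 := by
  have := ncard_fourCircuits_le_capSum_spread_of M hfree hns (d := 6) (by exact_mod_cast hd) qSpread fourCapSpecSpread_qSpread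
  rwa [capSum_qSpread_six] at this

/-- **THE `(14, 7)` SPREAD CAP: `s₄ ≤ 40`** on a spread coloop-free e-free core of nullity `7` on `21` points
(`s − ⌊4s/21⌋ ≤ 33`; the global cap was `56`). -/
theorem ncard_fourCircuits_le_forty_spread_twenty_one (M : Matroid α) [M.Finite]
    (hfree : ∀ e ∈ M.E, ∃ A ⊆ M.E \ {e}, e ∉ M.closure A ∧ e ∉ M.closure ((M.E \ {e}) \ A))
    (hns : ¬ ∃ W ⊆ M.E, W.ncard ≤ 9 ∧ W.encard = M.eRk W + 4) (hd : M.E.encard = M.eRank + 7)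
    (hn : M.E.ncard = 21) (hK : ∀ e, ¬ M.IsColoop e) :
    {C : Set α | M.IsCircuit C ∧ C.ncard = 4}.ncard ≤ 40 := by
  have hcol : M.coloops = ∅ := S2.coloops_eq_empty_of_forall_not M hK
  have hm : 21 ≤ (M.E \ M.coloops).ncard := by rw [hcol, Set.sdiff_empty, hn]
  have h := ncard_fourCircuits_sub_div_le_of_nonColoops_spread M hfree hns (d := 6) (by rw [hd]; norm_num) (by norm_num) hm
    (B := 33) (fun M' _ hfree' hns' hd'' => ncard_fourCircuits_le_thirty_three_spread M' hfree' hns' (by rw [hd'']; norm_num))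
  have := le_mul_div_of_sub_div_le (by norm_num : 4 < 21) h
  omega

end S1

end PercRepro
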